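import Summits.QuantumFields.BalabanUV.Beta.FP.SliceBiStencilReflection

/-!
# `BalabanUV.Beta.FP.SliceContactLetters` — road «FP» for binder row D1, sub-row **H2-ASM-5a (Kcov)** GLUON HALF, SLICE SECTOR: THE LETTERS THE R5′ SOCKET ASKS OF
# THE SLICE CONTACT TABLES — `sliceCt` and `sliceCtW` are BOUNDED and FINITELY SUPPORTED, hence `BiLoc` ∕ `VertexFamily(₂)` at `N = 1` with DISPLAYED constants; the two
# reflection laws read with the socket's bond map `bondRefl α 1`; the `hWloc` shape of the slice bi-table

HONEST DEPENDENCY (page 1, mandatory): continuum YM on T⁴ ⇐ BetaPertH ∧ nine spine estimates (0/9 proved); BetaPertH ⇐ (D1) ∧ (D4) ∧ CAP+tail;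
G-an2-4 gates asym, D1 and NE2/3/4.  HONEST FRAMING (cell contract, verbatim): «discharging `BetaPertH` makes Bałaban's UV stability UNCONDITIONAL —
a real constructive-QFT result; it is NOT the continuum limit and NOT the Clay problem.»  THIS MODULE DISCHARGES NOTHING of the wall: [folklore] indicator
bookkeeping on OUR explicit tables (`SliceVertexReflection.sliceCt` p251422, `SliceBiStencilReflection.sliceCtW` p254164, `SliceBiStencil.sliceW` p253873,
`SliceVertex.sliceA`), their closed forms BY NAME; 0 `def`, 0 `def … : Prop`, nothing cited, 0 sorry; 0∕4 row-D1 binders.  It supplies, for the SLICE summands only,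
the letter SHAPES of the laws-with-contact socket `PerfectAsymptoticsBFCov.axisReflectionCovariant_flipK_PiBF_contact₂` (`VertexFamily CtVα 1 Cc δ`,
`VertexFamily₂ CtWα 1 Cc₂ δ`, the two laws against `bondRefl α 1`) and the `hWloc` letter of `FineHessianNearLedger.hasym_PiBF_vertex2OfK_of_sliceLedger`.
NOT HERE (owner's pins): which leg map the instance uses (N-d1leaf02g9-1: `Φ N α` fixes the SITE-SWAPPED `Pker`, `PerfectPropagatorReflectionCell`), the perfect-jet
summands `S∞³ ∕ S∞⁴` (H2V-4′, abstract), the consistency identity (needs a (P-INV) letter).  NOT the (Kcov) instance, NOT H2V-4, NOT D1, NOT BetaPertH, NOT continuum, NOT Clay.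

ABSOLUTE RULE (cell charter, verbatim): «No internally-minted statement may enter as a cited fact. Every hypothesis is either kernel-proved in this package or a
verbatim quotation of a PUBLISHED theorem with page reference. The manuscript(s) under audit are NOT citable for their own disputed steps — they are the thing
under adjudication; programme-internal (2001/route/tribunal) claims are never citable.»

WHAT IS PROVED (general `d`, every rate `δ ≥ 0`, constants DISPLAYED).
* §1 the bond matrix of `d δ`: `abs_dz_codiff₁_delta1_le : |(dδ δ_{(b,z)})_a(x)| ≤ 2`, `dz_codiff₁_delta1_eq_zero_of_two_lt` ∕ `_eq_zero_or` (it vanishes unless `|z − x|₁ ≤ 2`).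
* §2 the first-order contact: `abs_sliceCt_le : |sliceCt| ≤ 2`, `sliceCt_eq_zero_or` (support `|x−u|₁ + |z−u|₁ ≤ 2`), **`biLoc_sliceCt : BiLoc (sliceCt d α κ u) u u (2·e^{2δ}) δ`**.
* §3 the second-order contact: `abs_sliceCtW_le : |sliceCtW| ≤ 10`, `sliceCtW_eq_zero_or` (support `|x−u|₁ + |w−u′|₁ ≤ 4`: the bond-coincidence coefficient forces
  `|u−u′|₁ ≤ 2`), **`biLoc_sliceCtW : BiLoc (sliceCtW d α κ u κ′ u′) u u′ (10·e^{4δ}) δ`**.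
* §4 THE LETTER SHAPES: `vertexFamily_sliceCt_one` (`Cc := |c|·2e^{2δ}` for the family `c • sliceCt d α`), `vertexFamily₂_sliceCtW_one` (`Cc₂ := |c|·10e^{4δ}`),
  `sliceA_bondRefl` ∕ `sliceW_bondRefl` (the laws p251422 ∕ p254164 with `bref α κ = bondRefl α 1 κ`, `ResolventReflection.bref_eq_bondRefl`), and
  **`biLoc_sliceW_zero : BiLoc (sliceW d μ 0 ν z) 0 z (4·e^{10δ}·e^{−δ|z|₁}) δ`** (the `hWloc` shape; `CwL(slice) := 4e^{10δ}`).
Provenance: D1 formalisation swarm seat b2b-balaban-beta-d1-formalise-leaf-02 gen 10 (road FP engine lineage), 2026-08-21.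
-/

noncomputable section

namespace Summit.QuantumFields.BalabanUV.Beta.FP.SliceContactLetters

open Finset
open scoped BigOperators
open Literature.MathematicalPhysics.QuantumFieldTheory.Balaban1983to89
open Literature.MathematicalPhysics.QuantumFieldTheory.Balaban1983to89.Beta
open AffineAveraging (Form0 Form1 unitVec unitVec_apply dz codiff₁)
open KKTFluctuationKernel (delta1 delta1_apply)
open ResolventReflection (bref Φ bref_eq_bondRefl)
open PolarizationSign (reflSign)
open KernelReflection (refK bondRefl)
open ExpKernelCalculus (MKer BiLoc VertexFamily VertexFamily₂)
open OneStepResolventKernel (Fib)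
open StepJetData (l1_unitVec l1_add_le)
open OneStepKernelFamily (l1_neg_eq)
open B12Sec2to5 (l1 l1_nonneg)
open Summit.QuantumFields.BalabanUV.Beta.WilsonReflectionContact (unitVec_eq)
open Summit.QuantumFields.BalabanUV.Beta.FP.SliceVertex (sEntry sEntry_apply sliceA abs_sEntry_le sEntry_eq_zero_or)
open Summit.QuantumFields.BalabanUV.Beta.FP.SliceVertexReflection (sliceCt sliceCt_inl_inl dz_codiff₁_delta1_apply sliceA_bref)
open Summit.QuantumFields.BalabanUV.Beta.FP.SliceBiStencil (sliceW biLoc_sliceW_pair sliceW_eq_zero_of_two_lt)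
open Summit.QuantumFields.BalabanUV.Beta.FP.SliceBiStencilReflection (sliceCtW sliceCtW_inl_inl sliceW_bref)

variable {d : ℕ}

/-! ## §1 The bond matrix of `d δ`: size and range -/

/-- [folklore] `|0|₁ = 0` in the shape `|y − y|₁ ≤ c` used below. -/
theorem l1_sub_self_le (y : Fin (d + 1) → ℤ) {c : ℝ} (hc : 0 ≤ c) : l1 (y - y) ≤ c := by
  rw [sub_self]; unfold B12Sec2to5.l1; simpa using hc

/-- [folklore] **`|(dδ δ_{(b,z)})_a(x)| ≤ 2`** (four indicators with signs `+ − − +`). -/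
theorem abs_dz_codiff₁_delta1_le (a b : Fin (d + 1)) (x z : Fin (d + 1) → ℤ) : |dz (codiff₁ (delta1 b z)) a x| ≤ 2 := by
  rw [dz_codiff₁_delta1_apply]
  split_ifs <;> norm_num

/-- [folklore] **FINITE RANGE of the bond matrix of `d δ`**: it vanishes unless `|z − x|₁ ≤ 2` (`z ∈ {x + e_a − e_b, x + e_a, x − e_b, x}`). -/
theorem dz_codiff₁_delta1_eq_zero_of_two_lt {a b : Fin (d + 1)} {x z : Fin (d + 1) → ℤ} (h : 2 < l1 (z - x)) :
    dz (codiff₁ (delta1 b z)) a x = 0 := by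
  rw [dz_codiff₁_delta1_apply]
  have h1 : ¬(x + unitVec a - unitVec b = z) := by
    intro e
    have e' : z - x = unitVec a + -unitVec b := by rw [← e]; abel
    have : l1 (z - x) ≤ 2 := by
      rw [e']; refine (l1_add_le _ _).trans ?_; norm_num [l1_neg_eq, unitVec_eq, l1_unitVec]
    linarith
  have h2 : ¬(x + unitVec a = z) := by
    intro e
    have e' : z - x = unitVec a := by rw [← e]; abel
    have : l1 (z - x) ≤ 2 := by norm_num [e', unitVec_eq, l1_unitVec]
    linarith
  have h3 : ¬(x - unitVec b = z) := by
    intro e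
    have e' : z - x = -unitVec b := by rw [← e]; abel
    have : l1 (z - x) ≤ 2 := by norm_num [e', l1_neg_eq, unitVec_eq, l1_unitVec]
    linarith
  have h4 : ¬(x = z) := by
    intro e
    have : l1 (z - x) ≤ 2 := by rw [e]; exact l1_sub_self_le z (by norm_num)
    linarith
  rw [if_neg h1, if_neg h2, if_neg h3, if_neg h4]; norm_num

/-- [folklore] the same as a dichotomy. -/
theorem dz_codiff₁_delta1_eq_zero_or (a b : Fin (d + 1)) (x z : Fin (d + 1) → ℤ) :
    dz (codiff₁ (delta1 b z)) a x = 0 ∨ l1 (z - x) ≤ 2 := by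
  by_cases h : l1 (z - x) ≤ 2
  · exact Or.inr h
  · exact Or.inl (dz_codiff₁_delta1_eq_zero_of_two_lt (not_le.1 h))

/-! ## §2 The first-order slice contact `sliceCt`: size, range, `BiLoc` -/

/-- [folklore] **`|sliceCt| ≤ 2`** (`[κ = α]`, the bond matrix of `d δ`, and a difference of two pins). -/
theorem abs_sliceCt_le (α κ : Fin (d + 1)) (u x z : Fin (d + 1) → ℤ) (a b : Fib d) : |sliceCt d α κ u x z a b| ≤ 2 := by
  rcases a with a | a <;> rcases b with b | b
  · rw [sliceCt_inl_inl, abs_mul, abs_mul]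
    have h1 : |(if κ = α then (1 : ℝ) else 0)| ≤ 1 := by split_ifs <;> norm_num
    have h2 := abs_dz_codiff₁_delta1_le a b x z
    have h3 : |((if x = u ∧ a = κ then (1 : ℝ) else 0) - (if z = u ∧ b = κ then (1 : ℝ) else 0))| ≤ 1 := by split_ifs <;> norm_num
    calc |(if κ = α then (1 : ℝ) else 0)| * |dz (codiff₁ (delta1 b z)) a x| *
          |((if x = u ∧ a = κ then (1 : ℝ) else 0) - (if z = u ∧ b = κ then (1 : ℝ) else 0))| ≤ 1 * 2 * 1 := by gcongr
      _ = 2 := by norm_num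
  · show |(0 : ℝ)| ≤ 2; rw [abs_zero]; norm_num
  · show |(0 : ℝ)| ≤ 2; rw [abs_zero]; norm_num
  · show |(0 : ℝ)| ≤ 2; rw [abs_zero]; norm_num

/-- [folklore] **FINITE RANGE of `sliceCt`**: an entry vanishes unless one leg IS the background site and the other lies within `ℓ¹`-distance 2 of it:
`|x − u|₁ + |z − u|₁ ≤ 2` on the support. -/
theorem sliceCt_eq_zero_or (α κ : Fin (d + 1)) (u x z : Fin (d + 1) → ℤ) (a b : Fib d) :
    sliceCt d α κ u x z a b = 0 ∨ l1 (x - u) + l1 (z - u) ≤ 2 := by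
  rcases a with a | a <;> rcases b with b | b
  · rw [sliceCt_inl_inl]
    rcases dz_codiff₁_delta1_eq_zero_or a b x z with h | h
    · left; rw [h, mul_zero, zero_mul]
    · by_cases hx : x = u ∧ a = κ
      · right; obtain ⟨rfl, -⟩ := hx
        have h0 := l1_sub_self_le x (le_refl (0 : ℝ))
        linarith
      · by_cases hz : z = u ∧ b = κ
        · right; obtain ⟨rfl, -⟩ := hz
          have h0 := l1_sub_self_le z (le_refl (0 : ℝ))
          have h' : l1 (x - z) ≤ 2 := by
            have e : x - z = -(z - x) := by abel
            rw [e, l1_neg_eq]; exact h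
          linarith
        · left; rw [if_neg hx, if_neg hz, sub_zero, mul_zero]
  · exact Or.inl rfl
  · exact Or.inl rfl
  · exact Or.inl rfl

/-- [folklore] **THE `BiLoc` LETTER OF THE FIRST-ORDER SLICE CONTACT**, explicit constant `Cc := 2·e^{2δ}` for every rate `δ ≥ 0`:
`BiLoc (sliceCt d α κ u) u u (2·e^{2δ}) δ`. -/
theorem biLoc_sliceCt {δ : ℝ} (hδ : 0 ≤ δ) (α κ : Fin (d + 1)) (u : Fin (d + 1) → ℤ) :
    BiLoc (sliceCt d α κ u) u u (2 * Real.exp (2 * δ)) δ := by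
  intro x z a b
  rcases sliceCt_eq_zero_or α κ u x z a b with h | h
  · rw [h, abs_zero]; positivity
  · have h1 : 1 ≤ Real.exp (2 * δ) * Real.exp (-δ * (l1 (x - u) + l1 (z - u))) := by
      rw [← Real.exp_add]
      exact Real.one_le_exp (by nlinarith [mul_nonneg hδ (sub_nonneg.2 h)])
    calc |sliceCt d α κ u x z a b| ≤ 2 * 1 := by rw [mul_one]; exact abs_sliceCt_le α κ u x z a b
      _ ≤ 2 * (Real.exp (2 * δ) * Real.exp (-δ * (l1 (x - u) + l1 (z - u)))) := mul_le_mul_of_nonneg_left h1 (by norm_num)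
      _ = _ := by ring

/-! ## §3 The second-order slice contact `sliceCtW`: size, range, `BiLoc` -/

/-- [folklore] arithmetic shape of the entry bound: `|A·B + C·D| ≤ 10` from `|A| ≤ 1`, `|B| ≤ 2`, `|C| ≤ 1`, `|D| ≤ 8`. -/
theorem abs_mul_add_mul_le_ten {A B C D : ℝ} (hA : |A| ≤ 1) (hB : |B| ≤ 2) (hC : |C| ≤ 1) (hD : |D| ≤ 8) : |A * B + C * D| ≤ 10 := by
  have h := abs_add_le (A * B) (C * D)
  rw [abs_mul, abs_mul] at h
  nlinarith [abs_nonneg A, abs_nonneg B, abs_nonneg C, abs_nonneg D, mul_le_mul hA hB (abs_nonneg B) zero_le_one,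
    mul_le_mul hC hD (abs_nonneg D) zero_le_one]

/-- [folklore] arithmetic shape of the diagonal word's bound: `|−(s₁ + s₂) + δ₁·z₁ + δ₂·z₂| ≤ 8`. -/
theorem abs_diagWord_le_eight {s₁ s₂ δ₁ z₁ δ₂ z₂ : ℝ} (h₁ : |s₁| ≤ 2) (h₂ : |s₂| ≤ 2) (h₃ : |δ₁| ≤ 1) (h₄ : |z₁| ≤ 2) (h₅ : |δ₂| ≤ 1)
    (h₆ : |z₂| ≤ 2) : |-(s₁ + s₂) + δ₁ * z₁ + δ₂ * z₂| ≤ 8 := by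
  have t1 := abs_add_le (-(s₁ + s₂) + δ₁ * z₁) (δ₂ * z₂)
  have t2 := abs_add_le (-(s₁ + s₂)) (δ₁ * z₁)
  have t3 := abs_add_le s₁ s₂
  rw [abs_neg] at t2
  rw [abs_mul] at t1 t2
  nlinarith [abs_nonneg δ₁, abs_nonneg z₁, abs_nonneg δ₂, abs_nonneg z₂, mul_le_mul h₃ h₄ (abs_nonneg z₁) zero_le_one,
    mul_le_mul h₅ h₆ (abs_nonneg z₂) zero_le_one]

/-- [folklore] **`|sliceCtW| ≤ 10`** (bond-coincidence coefficient `≤ 1` × pin pairs `≤ 2`, plus the diagonal word `≤ 8`). -/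
theorem abs_sliceCtW_le (α κ : Fin (d + 1)) (u : Fin (d + 1) → ℤ) (κ' : Fin (d + 1)) (u' x w : Fin (d + 1) → ℤ) (a b : Fib d) :
    |sliceCtW d α κ u κ' u' x w a b| ≤ 10 := by
  rcases a with a | a <;> rcases b with b | b
  · rw [sliceCtW_inl_inl]
    refine abs_mul_add_mul_le_ten ?_ ?_ ?_ ?_
    · split_ifs <;> norm_num
    · split_ifs <;> norm_num
    · split_ifs <;> norm_num
    · refine abs_diagWord_le_eight (abs_sEntry_le κ u w x b a) (abs_sEntry_le κ u x w a b) ?_ (abs_dz_codiff₁_delta1_le b a w x) ?_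
        (abs_dz_codiff₁_delta1_le a b x w)
      · rw [delta1_apply]; split_ifs <;> norm_num
      · rw [delta1_apply]; split_ifs <;> norm_num
  · show |(0 : ℝ)| ≤ 10; rw [abs_zero]; norm_num
  · show |(0 : ℝ)| ≤ 10; rw [abs_zero]; norm_num
  · show |(0 : ℝ)| ≤ 10; rw [abs_zero]; norm_num

/-- [folklore] **THE BOND-COINCIDENCE COEFFICIENT FORCES THE TWO BACKGROUND BONDS WITHIN `ℓ¹`-DISTANCE 2**: if `[u + e_κ = u′ + e_{κ′}] − [u + e_κ + [κ′=α]e_α =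
u′ + e_{κ′} + [κ=α]e_α] ≠ 0` then `|u − u′|₁ ≤ 2` (case by case on `κ = α`, `κ′ = α`: the shifted coincidence gives `u − u′ ∈ {0, e_{κ′}, −e_κ, e_{κ′} − e_κ}`). -/
theorem l1_le_two_of_coeff_ne_zero {α κ κ' : Fin (d + 1)} {u u' : Fin (d + 1) → ℤ}
    (h : ((if u + unitVec κ = u' + unitVec κ' then (1 : ℝ) else 0)
      - (if u + unitVec κ + (if κ' = α then unitVec α else 0) = u' + unitVec κ' + (if κ = α then unitVec α else 0) then (1 : ℝ) else 0)) ≠ 0) :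
    l1 (u - u') ≤ 2 := by
  by_cases c1 : u + unitVec κ = u' + unitVec κ'
  · have e : u - u' = unitVec κ' + -unitVec κ := by linear_combination c1
    rw [e]; refine (l1_add_le _ _).trans ?_; norm_num [l1_neg_eq, unitVec_eq, l1_unitVec]
  · by_cases c2 : u + unitVec κ + (if κ' = α then unitVec α else 0) = u' + unitVec κ' + (if κ = α then unitVec α else 0)
    · by_cases hκ : κ = α
      · by_cases hκ' : κ' = α
        · rw [if_pos hκ', if_pos hκ, hκ, hκ'] at c2
          have e : u - u' = 0 := by linear_combination c2
          rw [e, ← sub_self u]; exact l1_sub_self_le u (by norm_num)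
        · rw [if_neg hκ', if_pos hκ, hκ, add_zero] at c2
          have e : u - u' = unitVec κ' := by linear_combination c2
          norm_num [e, unitVec_eq, l1_unitVec]
      · by_cases hκ' : κ' = α
        · rw [if_pos hκ', if_neg hκ, hκ', add_zero] at c2
          have e : u - u' = -unitVec κ := by linear_combination c2
          norm_num [e, l1_neg_eq, unitVec_eq, l1_unitVec]
        · rw [if_neg hκ, if_neg hκ', add_zero, add_zero] at c2
          exact absurd c2 c1
    · exact absurd (by rw [if_neg c1, if_neg c2, sub_zero]) h

/-- [folklore] the pin pairs of `sliceCtW` vanish unless the legs sit AT the two background sites (straight or crossed): on their support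
`|x − u|₁ + |w − u′|₁ ≤ 2·|u − u′|₁`. -/
theorem l1_le_of_pins_ne_zero {κ κ' : Fin (d + 1)} {u u' x w : Fin (d + 1) → ℤ} {a b : Fin (d + 1)}
    (h : ((if x = u ∧ a = κ then (1 : ℝ) else 0) * (if w = u' ∧ b = κ' then 1 else 0)
      + (if w = u ∧ b = κ then (1 : ℝ) else 0) * (if x = u' ∧ a = κ' then 1 else 0)) ≠ 0) :
    l1 (x - u) + l1 (w - u') ≤ 2 * l1 (u - u') := by
  by_cases p1 : x = u ∧ a = κ
  · by_cases p2 : w = u' ∧ b = κ'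
    · obtain ⟨rfl, -⟩ := p1
      obtain ⟨rfl, -⟩ := p2
      have h0 := l1_sub_self_le x (le_refl (0 : ℝ))
      have h0' := l1_sub_self_le w (le_refl (0 : ℝ))
      nlinarith [l1_nonneg (x - w)]
    · by_cases p3 : w = u ∧ b = κ
      · by_cases p4 : x = u' ∧ a = κ'
        · obtain ⟨rfl, -⟩ := p1
          obtain ⟨rfl, -⟩ := p4
          obtain ⟨hw, -⟩ := p3
          rw [hw]
          have h0 := l1_sub_self_le x (le_refl (0 : ℝ))
          linarith
        · exact absurd (by rw [if_neg p2, if_neg p4, mul_zero, mul_zero, add_zero]) h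
      · exact absurd (by rw [if_neg p2, if_neg p3, mul_zero, zero_mul, add_zero]) h
  · by_cases p3 : w = u ∧ b = κ
    · by_cases p4 : x = u' ∧ a = κ'
      · obtain ⟨rfl, -⟩ := p3
        obtain ⟨rfl, -⟩ := p4
        have e : w - x = -(x - w) := by abel
        rw [e, l1_neg_eq]; linarith
      · exact absurd (by rw [if_neg p1, if_neg p4, zero_mul, mul_zero, add_zero]) h
    · exact absurd (by rw [if_neg p1, if_neg p3, zero_mul, zero_mul, add_zero]) h

/-- [folklore] the diagonal word of `sliceCtW` (present only for `u = u′`) vanishes unless both legs lie within `ℓ¹`-distance 2 of the background site: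
`|x − u|₁ + |w − u|₁ ≤ 4` on its support. -/
theorem l1_le_four_of_diagWord_ne_zero {κ : Fin (d + 1)} {u x w : Fin (d + 1) → ℤ} {a b : Fin (d + 1)}
    (h : (-(sEntry d κ u w x b a + sEntry d κ u x w a b)
      + delta1 κ u b w * dz (codiff₁ (delta1 a x)) b w + delta1 κ u a x * dz (codiff₁ (delta1 b w)) a x) ≠ 0) :
    l1 (x - u) + l1 (w - u) ≤ 4 := by
  by_contra hs
  apply h
  have e1 : sEntry d κ u w x b a = 0 := by
    rcases sEntry_eq_zero_or κ u w x b a with h1 | ⟨hw, hx⟩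
    · exact h1
    · exact absurd (by linarith) hs
  have e2 : sEntry d κ u x w a b = 0 := by
    rcases sEntry_eq_zero_or κ u x w a b with h1 | ⟨hx, hw⟩
    · exact h1
    · exact absurd (by linarith) hs
  have e3 : delta1 κ u b w * dz (codiff₁ (delta1 a x)) b w = 0 := by
    rcases dz_codiff₁_delta1_eq_zero_or b a w x with h1 | h1
    · rw [h1, mul_zero]
    · rw [delta1_apply]
      by_cases hw : b = κ ∧ w = u
      · obtain ⟨-, rfl⟩ := hw
        have h0 := l1_sub_self_le w (le_refl (0 : ℝ))
        exact absurd (by linarith) hs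
      · rw [if_neg hw, zero_mul]
  have e4 : delta1 κ u a x * dz (codiff₁ (delta1 b w)) a x = 0 := by
    rcases dz_codiff₁_delta1_eq_zero_or a b x w with h1 | h1
    · rw [h1, mul_zero]
    · rw [delta1_apply]
      by_cases hx : a = κ ∧ x = u
      · obtain ⟨-, rfl⟩ := hx
        have h0 := l1_sub_self_le x (le_refl (0 : ℝ))
        exact absurd (by linarith) hs
      · rw [if_neg hx, zero_mul]
  rw [e1, e2, e3, e4]; norm_num

/-- [folklore] arithmetic shape: `A·B + C·D = 0` from `A·B = 0` and `C·D = 0`. -/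
theorem mul_add_mul_eq_zero {A B C D : ℝ} (h1 : A * B = 0) (h2 : C * D = 0) : A * B + C * D = 0 := by rw [h1, h2, add_zero]

/-- [folklore] **FINITE RANGE of `sliceCtW`**: an entry vanishes unless `|x − u|₁ + |w − u′|₁ ≤ 4`. -/
theorem sliceCtW_eq_zero_or (α κ : Fin (d + 1)) (u : Fin (d + 1) → ℤ) (κ' : Fin (d + 1)) (u' x w : Fin (d + 1) → ℤ) (a b : Fib d) :
    sliceCtW d α κ u κ' u' x w a b = 0 ∨ l1 (x - u) + l1 (w - u') ≤ 4 := by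
  by_cases hs : l1 (x - u) + l1 (w - u') ≤ 4
  · exact Or.inr hs
  · left
    rcases a with a | a <;> rcases b with b | b
    · rw [sliceCtW_inl_inl]
      refine mul_add_mul_eq_zero ?_ ?_
      · by_contra hAB
        have hA := l1_le_two_of_coeff_ne_zero (left_ne_zero_of_mul hAB)
        have hB := l1_le_of_pins_ne_zero (right_ne_zero_of_mul hAB)
        exact hs (hB.trans (by linarith))
      · by_contra hCD
        have hC := left_ne_zero_of_mul hCD
        have hD := l1_le_four_of_diagWord_ne_zero (right_ne_zero_of_mul hCD)
        have hu : u = u' ∧ κ = κ' := by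
          by_contra hu
          exact hC (by rw [if_neg hu, mul_zero])
        obtain ⟨rfl, -⟩ := hu
        exact hs hD
    · rfl
    · rfl
    · rfl

/-- [folklore] **THE `BiLoc` LETTER OF THE SECOND-ORDER SLICE CONTACT**, explicit constant `Cc₂ := 10·e^{4δ}` for every rate `δ ≥ 0`:
`BiLoc (sliceCtW d α κ u κ′ u′) u u′ (10·e^{4δ}) δ`. -/
theorem biLoc_sliceCtW {δ : ℝ} (hδ : 0 ≤ δ) (α κ : Fin (d + 1)) (u : Fin (d + 1) → ℤ) (κ' : Fin (d + 1)) (u' : Fin (d + 1) → ℤ) :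
    BiLoc (sliceCtW d α κ u κ' u') u u' (10 * Real.exp (4 * δ)) δ := by
  intro x w a b
  rcases sliceCtW_eq_zero_or α κ u κ' u' x w a b with h | h
  · rw [h, abs_zero]; positivity
  · have h1 : 1 ≤ Real.exp (4 * δ) * Real.exp (-δ * (l1 (x - u) + l1 (w - u'))) := by
      rw [← Real.exp_add]
      exact Real.one_le_exp (by nlinarith [mul_nonneg hδ (sub_nonneg.2 h)])
    calc |sliceCtW d α κ u κ' u' x w a b| ≤ 10 * 1 := by rw [mul_one]; exact abs_sliceCtW_le α κ u κ' u' x w a b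
      _ ≤ 10 * (Real.exp (4 * δ) * Real.exp (-δ * (l1 (x - u) + l1 (w - u')))) := mul_le_mul_of_nonneg_left h1 (by norm_num)
      _ = _ := by ring

/-! ## §4 The letter shapes of the socket -/

/-- [folklore] **THE `VertexFamily` LETTER AT `N = 1` OF THE SCALED FIRST-ORDER CONTACT** `c • sliceCt d α` (the law `sliceA_bref` has `c = −1`):
`VertexFamily (fun μ y => c • sliceCt d α μ y) 1 (|c|·2e^{2δ}) δ`. -/
theorem vertexFamily_sliceCt_one {δ : ℝ} (hδ : 0 ≤ δ) (α : Fin (d + 1)) (c : ℝ) :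
    VertexFamily (fun μ y => c • sliceCt d α μ y) 1 (|c| * (2 * Real.exp (2 * δ))) δ := by
  intro μ y x z a b
  simp only [Nat.cast_one, one_smul, Pi.smul_apply, smul_eq_mul]
  rw [abs_mul]
  calc |c| * |sliceCt d α μ y x z a b| ≤ |c| * (2 * Real.exp (2 * δ) * Real.exp (-δ * (l1 (x - y) + l1 (z - y)))) :=
        mul_le_mul_of_nonneg_left (biLoc_sliceCt hδ α μ y x z a b) (abs_nonneg c)
    _ = _ := by ring

/-- [folklore] **THE `VertexFamily₂` LETTER AT `N = 1` OF THE SCALED SECOND-ORDER CONTACT** `c • sliceCtW d α` (the law `sliceW_bref` has `c = 1`):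
`VertexFamily₂ (fun μ y ν y′ => c • sliceCtW d α μ y ν y′) 1 (|c|·10e^{4δ}) δ`. -/
theorem vertexFamily₂_sliceCtW_one {δ : ℝ} (hδ : 0 ≤ δ) (α : Fin (d + 1)) (c : ℝ) :
    VertexFamily₂ (fun μ y ν y' => c • sliceCtW d α μ y ν y') 1 (|c| * (10 * Real.exp (4 * δ))) δ := by
  intro μ y ν y' x w a b
  simp only [Nat.cast_one, one_smul, Pi.smul_apply, smul_eq_mul]
  rw [abs_mul]
  calc |c| * |sliceCtW d α μ y ν y' x w a b| ≤ |c| * (10 * Real.exp (4 * δ) * Real.exp (-δ * (l1 (x - y) + l1 (w - y')))) :=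
        mul_le_mul_of_nonneg_left (biLoc_sliceCtW hδ α μ y ν y' x w a b) (abs_nonneg c)
    _ = _ := by ring

/-- [folklore] **THE FIRST-ORDER LAW READ WITH THE SOCKET'S BOND MAP** `bondRefl α 1` (`bref α κ = bondRefl α 1 κ`):
`sliceA d μ (bondRefl α 1 μ y) = ε_μ • refK (Φ N α) (sliceA d μ y + (−1) • sliceCt d α μ y)`. -/
theorem sliceA_bondRefl (N : ℕ) (α μ : Fin (d + 1)) (y : Fin (d + 1) → ℤ) :
    sliceA d μ (bondRefl α 1 μ y) = reflSign α μ • refK (Φ N α) (sliceA d μ y + (-1 : ℝ) • sliceCt d α μ y) := by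
  rw [← bref_eq_bondRefl]; exact sliceA_bref N α μ y

/-- [folklore] **THE SECOND-ORDER LAW READ WITH THE SOCKET'S BOND MAP**:
`sliceW d μ (bondRefl α 1 μ y) ν (bondRefl α 1 ν y′) = (ε_μ ε_ν) • refK (Φ N α) (sliceW d μ y ν y′ + sliceCtW d α μ y ν y′)`. -/
theorem sliceW_bondRefl (N : ℕ) (α μ : Fin (d + 1)) (y : Fin (d + 1) → ℤ) (ν : Fin (d + 1)) (y' : Fin (d + 1) → ℤ) :
    sliceW d μ (bondRefl α 1 μ y) ν (bondRefl α 1 ν y') =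
      (reflSign α μ * reflSign α ν) • refK (Φ N α) (sliceW d μ y ν y' + sliceCtW d α μ y ν y') := by
  rw [← bref_eq_bondRefl, ← bref_eq_bondRefl]; exact sliceW_bref N α μ y ν y'

/-- [folklore] **THE `hWloc` LETTER OF THE SLICE BI-TABLE**, explicit constant `CwL := 4·e^{10δ}` for every rate `δ ≥ 0`: `BiLoc (sliceW d μ 0 ν z) 0 z (4e^{10δ}·e^{−δ|z|₁}) δ`
(from `biLoc_sliceW_pair`: the family vanishes unless `|z|₁ ≤ 2`, `sliceW_eq_zero_of_two_lt`). -/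
theorem biLoc_sliceW_zero {δ : ℝ} (hδ : 0 ≤ δ) (μ ν : Fin (d + 1)) (z : Fin (d + 1) → ℤ) :
    BiLoc (sliceW d μ 0 ν z) 0 z (4 * Real.exp (10 * δ) * Real.exp (-δ * l1 z)) δ := by
  intro x w a b
  by_cases hfar : 2 < l1 (z - 0)
  · rw [sliceW_eq_zero_of_two_lt hfar]
    show |(0 : ℝ)| ≤ _
    rw [abs_zero]; positivity
  · have hz : l1 z ≤ 2 := by rw [← sub_zero z]; exact not_lt.1 hfar
    have hp := biLoc_sliceW_pair hδ μ 0 ν z x w a b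
    have h1 : Real.exp (8 * δ) ≤ Real.exp (10 * δ) * Real.exp (-δ * l1 z) := by
      rw [← Real.exp_add]; exact Real.exp_le_exp.2 (by nlinarith [mul_nonneg hδ (sub_nonneg.2 hz)])
    have h5 : 0 ≤ Real.exp (-δ * (l1 (x - 0) + l1 (w - z))) := (Real.exp_pos _).le
    calc |sliceW d μ 0 ν z x w a b| ≤ 4 * Real.exp (8 * δ) * Real.exp (-δ * (l1 (x - 0) + l1 (w - z))) := hp
      _ ≤ 4 * (Real.exp (10 * δ) * Real.exp (-δ * l1 z)) * Real.exp (-δ * (l1 (x - 0) + l1 (w - z))) := by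
          exact mul_le_mul_of_nonneg_right (mul_le_mul_of_nonneg_left h1 (by norm_num)) h5
      _ = _ := by ring

end Summit.QuantumFields.BalabanUV.Beta.FP.SliceContactLetters

end
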